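import Summits.ResolutionOfSingularities.ResolutionOfSingularities.Theorems.FrobeniusLadderFInjectiveMacaulayficationNewtonChartLemmaWeak
import Summits.ResolutionOfSingularities.ResolutionOfSingularities.Theorems.FrobeniusLadderFInjectiveMacaulayficationLx3p3Newton
import Mathlib.Algebra.CharP.Lemmas
import HarnessLib

/-!
# (W-ND)⁺ «TJURINA UPGRADE» (C): EVERY BED OF THE F-HALF CENSUS IS WEAKLY (TJURINA) NON-DEGENERATE ALONG EVERY COMPACT FACE — a «good support» criterion and its instances
# (crux `FInjectiveMacaulayfication` stmt-ResolutionOfSingularities-15315, chain w45a; seat res-L1-w45a-stub-3 g11, FINDING + OFFER STATUS 18:02Z; feeds (A)/(B)/(B′):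
# `NewtonChartLemma.ishii_lemma_4_4_24_weak`, `FHalfRowOfNewtonNondegenerate.fHalfRow_of_weaklyNondegenerate`)

[OURS · L1 W4.5a] Support file (`--supports stmt-ResolutionOfSingularities-15315 --as helper`); def-free; UNCONDITIONAL; no named fact. NOT a statement of any manuscript.
AI-written (AI review is weaker than expert review).

THE CRITERION (§1 `not_tjurinaZero_face`, ★ `weaklyNondegenerate_of_good_support`). Let `f ∈ k[X_0..X_{m-1}]`, `f ≠ 0`, and `β₀` one designated exponent. Call `α ∈ supp f` GOOD if some variable
`X_i` occurs in `α` with exponent `≢ 0 (mod char k)` while its exponent in EVERY OTHER monomial of `f` is `≡ 0 (mod char k)` («private up to p-th powers»). If every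
`α ∈ supp f` other than `β₀` is good, then `f` is weakly non-degenerate along EVERY positive weight `w`: the face `F` of `w` is non-empty; if it contains a good `α` then
`∂_i f_F = c_α α_i X^{α−e_i}` is a non-zero monomial, so the Jacobian of `f_F` has no torus zero; otherwise `F = {β₀}` and `f_F = c X^{β₀}` itself has no torus zero. (The
designated `β₀` is where `IsNewtonNondegenerate` may FAIL — the Jacobian of `X^{β₀}` vanishes identically when `p ∣ β₀` — while the TJURINA condition holds.)
INSTANCES (§2–§3): ★ `weaklyNondegenerate_bedW` — BED W `z³ + x⁴ + y⁵ + u⁵ + t⁷`, char 3 (`β₀ = 3e_z`; good: `x⁴, y⁵, u⁵, t⁷`); ★ `weaklyNondegenerate_bed42` — the whole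
(4,2) family `z² + x^a z + y^b + u^c + t^d`, char 2, `b, c, d` odd (`β₀ = 2e_z`; good: `x^a z` via `∂_z`, and `y^b, u^c, t^d`): P2d4C (4;3,3,3), P2d4F5 (2;5,5,5), P2d4B (2;3,3,5),
d4lx6q7 (6;3,3,7), d4lx6c5 (6;3,3,5), d4lx6c3 (6;3,3,3); ★ `weaklyNondegenerate_bed52` — the (5,2) family `z² + x^a z + y^b + u^c + t^d + s^e` (P2d5C, d5lx6q7).
So the census beds, filed as «Kouchnirenko-DEGENERATE» (true for the Jacobian notion), are all inside the TJURINA-tame class of (B′).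
[cite: BoubakriGreuelMarkwig2010, §3 (p. 10)] [cite: IshiiSingularities2018, Def. 4.4.22]
-/

-- single-problem summit: the doubled namespace component is forced
set_option linter.dupNamespace false

noncomputable section

open MvPolynomial

namespace Summit.ResolutionOfSingularities.ResolutionOfSingularities.Theorems.FInjectiveMacaulayfication.CensusBedsWeaklyNondegenerate

open Summit.ResolutionOfSingularities.ResolutionOfSingularities.Theorems.FInjectiveMacaulayfication
open Literature.AlgebraicGeometry.Resolution Literature.AlgebraicGeometry.Resolution.BoubakriGreuelMarkwig NewtonChartLemma

variable {k : Type} [Field k] {m : ℕ}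

/-! ## §1 ★ The «good support» criterion for weak non-degeneracy along every positive weight -/

/-- A torus point has non-vanishing monomials. [plumbing] -/
theorem eval_monomial_ne_zero (q : Fin m → k) (hq : ∀ i, q i ≠ 0) (γ : Fin m →₀ ℕ) (c : k) (hc : c ≠ 0) :
    MvPolynomial.eval q (monomial γ c) ≠ 0 := by
  rw [eval_monomial]
  exact mul_ne_zero hc (Finset.prod_ne_zero_iff.mpr fun j _ => pow_ne_zero _ (hq j))

/-- **Core of the criterion, at one face.** If the face set `F ⊆ supp f` (the exponents of minimal `w`-weight) is such that every `α ∈ F` other than `β₀` is GOOD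
(below), then no torus point is a Tjurina zero of the face polynomial `f_F = Σ_{α∈F} a_α X^α`. [OURS · elementary; cite: BoubakriGreuelMarkwig2010, §3 (p. 10)] -/
theorem not_tjurinaZero_face (f : MvPolynomial (Fin m) k) (β₀ : Fin m →₀ ℕ)
    (hgood : ∀ α ∈ f.support, α ≠ β₀ → ∃ i : Fin m, ((α i : ℕ) : k) ≠ 0 ∧ ∀ β ∈ f.support, β ≠ α → ((β i : ℕ) : k) = 0)
    (F : Finset (Fin m →₀ ℕ)) (hFsub : ∀ β ∈ F, β ∈ f.support) (hFne : F.Nonempty) (q : Fin m → k) (hq : ∀ i, q i ≠ 0)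
    (h0 : MvPolynomial.eval q (∑ α ∈ F, monomial α (coeff α f)) = 0)
    (hJ : ∀ i : Fin m, MvPolynomial.eval q (pderiv i (∑ α ∈ F, monomial α (coeff α f))) = 0) : False := by
  classical
  by_cases hex : ∃ α ∈ F, α ≠ β₀
  · -- a good exponent lies on the face: `∂_i f_F (q) = c_α α_i q^{α - e_i} ≠ 0`
    obtain ⟨α, hαF, hαne⟩ := hex
    obtain ⟨i, hαi, hβi⟩ := hgood α (hFsub α hαF) hαne
    have hJi := hJ i
    rw [map_sum, map_sum, Finset.sum_eq_single α (fun β hβ hβα => by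
        rw [pderiv_monomial, hβi β (hFsub β hβ) hβα, mul_zero, monomial_zero, map_zero]) (fun h => (h hαF).elim),
      pderiv_monomial] at hJi
    exact eval_monomial_ne_zero q hq _ _ (mul_ne_zero (MvPolynomial.mem_support_iff.mp (hFsub α hαF)) hαi) hJi
  · -- the face is the lone vertex `β₀`: `f_F = c X^{β₀}` has no torus zero
    push Not at hex
    obtain ⟨α₁, hα₁F⟩ := hFne
    have hβ₀F : β₀ ∈ F := hex α₁ hα₁F ▸ hα₁F
    have hFeq : F = {β₀} := Finset.eq_singleton_iff_unique_mem.mpr ⟨hβ₀F, hex⟩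
    rw [hFeq, Finset.sum_singleton] at h0
    exact eval_monomial_ne_zero q hq _ _ (MvPolynomial.mem_support_iff.mp (hFsub β₀ hβ₀F)) h0

/-- ★ **THE «GOOD SUPPORT» CRITERION.** `f ≠ 0`; every exponent `α ∈ supp f` other than the designated `β₀` is GOOD: some `X_i` has exponent `α_i ≢ 0 (mod char k)` in `α` and
exponent `≡ 0 (mod char k)` in every other monomial of `f`. Then `f` is WEAKLY non-degenerate (BGM: the Tjurina ideal of the initial form has no torus zero) along EVERY positive
real weight (the initial form along `w` is the face polynomial of the minimal-weight exponents, res-L1-w45a-stub-1's `NewtonChartLemma.initialForm_coe_real`).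
[OURS · elementary; cite: BoubakriGreuelMarkwig2010, §3 (p. 10)] -/
theorem weaklyNondegenerate_of_good_support (f : MvPolynomial (Fin m) k) (hf : f ≠ 0) (β₀ : Fin m →₀ ℕ)
    (hgood : ∀ α ∈ f.support, α ≠ β₀ → ∃ i : Fin m, ((α i : ℕ) : k) ≠ 0 ∧ ∀ β ∈ f.support, β ≠ α → ((β i : ℕ) : k) = 0) :
    ∀ w : Fin m → ℝ, (∀ i, 0 < w i) → IsWeaklyNondegenerateAlong w (f : MvPowerSeries (Fin m) k) := by
  classical
  intro w _ q hq hT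
  unfold IsTjurinaZero IsJacobianZero at hT
  rw [initialForm_coe_real f w] at hT
  simp only [pderiv_coe, evalAt_coe] at hT
  obtain ⟨α₁, hα₁, hmin⟩ := Finset.exists_min_image f.support (fun α => wdeg w α) (MvPolynomial.support_nonempty.mpr hf)
  exact not_tjurinaZero_face f β₀ hgood _ (fun β hβ => (Finset.mem_filter.mp hβ).1) ⟨α₁, Finset.mem_filter.mpr ⟨hα₁, hmin⟩⟩ q hq hT.1 hT.2

/-! ## §2 Plumbing for the instances: supports of five- and six-term sums of monomials; casts in characteristic `p` -/

/-- `(n : k) ≠ 0` when `char k ∤ n`. [folklore] -/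
theorem natCast_ne_zero_of_not_dvd (p : ℕ) [CharP k p] (n : ℕ) (h : ¬ p ∣ n) : ((n : ℕ) : k) ≠ 0 :=
  fun h0 => h ((CharP.cast_eq_zero_iff k p n).mp h0)

/-- `(n : k) = 0` when `char k ∣ n`. [folklore] -/
theorem natCast_eq_zero_of_dvd (p : ℕ) [CharP k p] (n : ℕ) (h : p ∣ n) : ((n : ℕ) : k) = 0 :=
  (CharP.cast_eq_zero_iff k p n).mpr h

/-- Membership in the support of a monomial pins the exponent. [plumbing] -/
theorem eq_of_mem_support_monomial {α γ : Fin m →₀ ℕ} {c : k} (h : α ∈ (monomial γ c).support) : α = γ := by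
  classical
  exact Finset.mem_singleton.mp (support_monomial_subset h)

/-- Support of a five-term sum. [plumbing] -/
theorem mem_support_add5 {p₁ p₂ p₃ p₄ p₅ : MvPolynomial (Fin m) k} {α : Fin m →₀ ℕ} (h : α ∈ (p₁ + p₂ + p₃ + p₄ + p₅).support) :
    α ∈ p₁.support ∨ α ∈ p₂.support ∨ α ∈ p₃.support ∨ α ∈ p₄.support ∨ α ∈ p₅.support := by
  classical
  rcases Finset.mem_union.mp (support_add h) with h | h
  · rcases Finset.mem_union.mp (support_add h) with h | h
    · rcases Finset.mem_union.mp (support_add h) with h | h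
      · rcases Finset.mem_union.mp (support_add h) with h | h
        · exact Or.inl h
        · exact Or.inr (Or.inl h)
      · exact Or.inr (Or.inr (Or.inl h))
    · exact Or.inr (Or.inr (Or.inr (Or.inl h)))
  · exact Or.inr (Or.inr (Or.inr (Or.inr h)))

/-- Support of a six-term sum. [plumbing] -/
theorem mem_support_add6 {p₁ p₂ p₃ p₄ p₅ p₆ : MvPolynomial (Fin m) k} {α : Fin m →₀ ℕ} (h : α ∈ (p₁ + p₂ + p₃ + p₄ + p₅ + p₆).support) :
    α ∈ p₁.support ∨ α ∈ p₂.support ∨ α ∈ p₃.support ∨ α ∈ p₄.support ∨ α ∈ p₅.support ∨ α ∈ p₆.support := by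
  classical
  rcases Finset.mem_union.mp (support_add h) with h | h
  · rcases mem_support_add5 h with h | h | h | h | h
    · exact Or.inl h
    · exact Or.inr (Or.inl h)
    · exact Or.inr (Or.inr (Or.inl h))
    · exact Or.inr (Or.inr (Or.inr (Or.inl h)))
    · exact Or.inr (Or.inr (Or.inr (Or.inr (Or.inl h))))
  · exact Or.inr (Or.inr (Or.inr (Or.inr (Or.inr h))))

/-! ## §3 ★ The instances: BED W (char 3), the (4,2) family and the (5,2) family (char 2) -/

/-- ★ **BED W `z³ + x⁴ + y⁵ + u⁵ + t⁷` (char 3; `X 0..X 4 = x,y,u,t,z`) IS WEAKLY NON-DEGENERATE ALONG EVERY POSITIVE WEIGHT** (`β₀ = 3e_z`: the Jacobian-degenerate vertex;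
good exponents `x⁴, y⁵, u⁵, t⁷` with `4, 5, 5, 7 ≢ 0 (mod 3)` in private variables). [OURS · elementary certificate; cite: BoubakriGreuelMarkwig2010, §3 (p. 10)] -/
theorem weaklyNondegenerate_bedW (k : Type) [Field k] [CharP k 3] (f : MvPolynomial (Fin 5) k)
    (hf : f = X 4 ^ 3 + X 0 ^ 4 + X 1 ^ 5 + X 2 ^ 5 + X 3 ^ 7) :
    ∀ w : Fin 5 → ℝ, (∀ i, 0 < w i) → IsWeaklyNondegenerateAlong w (f : MvPowerSeries (Fin 5) k) := by
  classical
  have hf' : f = monomial (Finsupp.single 4 3) 1 + monomial (Finsupp.single 0 4) 1 + monomial (Finsupp.single 1 5) 1 +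
      monomial (Finsupp.single 2 5) 1 + monomial (Finsupp.single 3 7) 1 := by
    rw [hf]; simp only [X_pow_eq_monomial]
  have hsupp : ∀ α ∈ f.support, α = Finsupp.single 4 3 ∨ α = Finsupp.single 0 4 ∨ α = Finsupp.single 1 5 ∨ α = Finsupp.single 2 5 ∨ α = Finsupp.single 3 7 := by
    intro α hα
    rw [hf'] at hα
    rcases mem_support_add5 hα with h | h | h | h | h
    · exact Or.inl (eq_of_mem_support_monomial h)
    · exact Or.inr (Or.inl (eq_of_mem_support_monomial h))
    · exact Or.inr (Or.inr (Or.inl (eq_of_mem_support_monomial h)))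
    · exact Or.inr (Or.inr (Or.inr (Or.inl (eq_of_mem_support_monomial h))))
    · exact Or.inr (Or.inr (Or.inr (Or.inr (eq_of_mem_support_monomial h))))
  have hf0 : f ≠ 0 := by
    intro h0
    have := congrArg (MvPolynomial.eval (Pi.single 0 1 : Fin 5 → k)) h0
    rw [hf] at this
    simp at this
  have h4 : ((4 : ℕ) : k) ≠ 0 := natCast_ne_zero_of_not_dvd 3 4 (by norm_num)
  have h5 : ((5 : ℕ) : k) ≠ 0 := natCast_ne_zero_of_not_dvd 3 5 (by norm_num)
  have h7 : ((7 : ℕ) : k) ≠ 0 := natCast_ne_zero_of_not_dvd 3 7 (by norm_num)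
  refine weaklyNondegenerate_of_good_support f hf0 (Finsupp.single 4 3) (fun α hα hne => ?_)
  rcases hsupp α hα with rfl | rfl | rfl | rfl | rfl
  · exact (hne rfl).elim
  · refine ⟨0, by simpa using h4, fun β hβ hβne => ?_⟩
    rcases hsupp β hβ with rfl | rfl | rfl | rfl | rfl
    · simp
    · exact (hβne rfl).elim
    · simp
    · simp
    · simp
  · refine ⟨1, by simpa using h5, fun β hβ hβne => ?_⟩
    rcases hsupp β hβ with rfl | rfl | rfl | rfl | rfl
    · simp
    · simp
    · exact (hβne rfl).elim
    · simp
    · simp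
  · refine ⟨2, by simpa using h5, fun β hβ hβne => ?_⟩
    rcases hsupp β hβ with rfl | rfl | rfl | rfl | rfl
    · simp
    · simp
    · simp
    · exact (hβne rfl).elim
    · simp
  · refine ⟨3, by simpa using h7, fun β hβ hβne => ?_⟩
    rcases hsupp β hβ with rfl | rfl | rfl | rfl | rfl
    · simp
    · simp
    · simp
    · simp
    · exact (hβne rfl).elim

/-- ★ **THE (4,2) FAMILY `z² + x^a z + y^b + u^c + t^d` (char 2; `X 0..X 4 = x,y,u,t,z`; `b, c, d` odd; any `a`) IS WEAKLY NON-DEGENERATE ALONG EVERY POSITIVE WEIGHT**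
(`β₀ = 2e_z`; good: `x^a z` via `∂_z` — `z` has exponent `1` there and even exponent elsewhere — and `y^b, u^c, t^d` in private variables with odd exponents). Instances:
P2d4C `(a;b,c,d) = (4;3,3,3)`, P2d4F5 `(2;5,5,5)`, P2d4B `(2;3,3,5)`, d4lx6q7 `(6;3,3,7)`, d4lx6c5 `(6;3,3,5)`, d4lx6c3 `(6;3,3,3)`.
[OURS · elementary certificate; cite: BoubakriGreuelMarkwig2010, §3 (p. 10)] -/
theorem weaklyNondegenerate_bed42 (k : Type) [Field k] [CharP k 2] (a b c d : ℕ) (hb : Odd b) (hc : Odd c) (hd : Odd d) (f : MvPolynomial (Fin 5) k)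
    (hf : f = X 4 ^ 2 + X 0 ^ a * X 4 + X 1 ^ b + X 2 ^ c + X 3 ^ d) :
    ∀ w : Fin 5 → ℝ, (∀ i, 0 < w i) → IsWeaklyNondegenerateAlong w (f : MvPowerSeries (Fin 5) k) := by
  classical
  have hf' : f = monomial (Finsupp.single 4 2) 1 + monomial (Finsupp.single 0 a + Finsupp.single 4 1) 1 + monomial (Finsupp.single 1 b) 1 +
      monomial (Finsupp.single 2 c) 1 + monomial (Finsupp.single 3 d) 1 := by
    rw [hf]; simp only [X_pow_eq_monomial]; rw [X, monomial_mul, mul_one]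
  have hsupp : ∀ α ∈ f.support, α = Finsupp.single 4 2 ∨ α = Finsupp.single 0 a + Finsupp.single 4 1 ∨ α = Finsupp.single 1 b ∨
      α = Finsupp.single 2 c ∨ α = Finsupp.single 3 d := by
    intro α hα
    rw [hf'] at hα
    rcases mem_support_add5 hα with h | h | h | h | h
    · exact Or.inl (eq_of_mem_support_monomial h)
    · exact Or.inr (Or.inl (eq_of_mem_support_monomial h))
    · exact Or.inr (Or.inr (Or.inl (eq_of_mem_support_monomial h)))
    · exact Or.inr (Or.inr (Or.inr (Or.inl (eq_of_mem_support_monomial h))))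
    · exact Or.inr (Or.inr (Or.inr (Or.inr (eq_of_mem_support_monomial h))))
  have hf0 : f ≠ 0 := by
    intro h0
    have := congrArg (MvPolynomial.eval (Pi.single 1 1 : Fin 5 → k)) h0
    rw [hf] at this
    simp [zero_pow hc.pos.ne', zero_pow hd.pos.ne'] at this
  have h2 : (2 : k) = 0 := by simpa using natCast_eq_zero_of_dvd (k := k) 2 2 dvd_rfl
  have hodd : ∀ n : ℕ, Odd n → ((n : ℕ) : k) ≠ 0 := fun n hn =>
    natCast_ne_zero_of_not_dvd 2 n (Nat.two_dvd_ne_zero.mpr (Nat.odd_iff.mp hn))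
  refine weaklyNondegenerate_of_good_support f hf0 (Finsupp.single 4 2) (fun α hα hne => ?_)
  rcases hsupp α hα with rfl | rfl | rfl | rfl | rfl
  · exact (hne rfl).elim
  · refine ⟨4, by simp, fun β hβ hβne => ?_⟩
    rcases hsupp β hβ with rfl | rfl | rfl | rfl | rfl
    · simp [h2]
    · exact (hβne rfl).elim
    · simp
    · simp
    · simp
  · refine ⟨1, by simpa using hodd b hb, fun β hβ hβne => ?_⟩
    rcases hsupp β hβ with rfl | rfl | rfl | rfl | rfl
    · simp
    · simp
    · exact (hβne rfl).elim
    · simp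
    · simp
  · refine ⟨2, by simpa using hodd c hc, fun β hβ hβne => ?_⟩
    rcases hsupp β hβ with rfl | rfl | rfl | rfl | rfl
    · simp
    · simp
    · simp
    · exact (hβne rfl).elim
    · simp
  · refine ⟨3, by simpa using hodd d hd, fun β hβ hβne => ?_⟩
    rcases hsupp β hβ with rfl | rfl | rfl | rfl | rfl
    · simp
    · simp
    · simp
    · simp
    · exact (hβne rfl).elim

/-- ★ **THE (5,2) FAMILY `z² + x^a z + y^b + u^c + t^d + s^e` (char 2; `X 0..X 5 = x,y,u,t,s,z`; `b, c, d, e` odd) IS WEAKLY NON-DEGENERATE ALONG EVERY POSITIVE WEIGHT.**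
Instances: P2d5C `(4;3,3,3,3)`, d5lx6q7-type beds. [OURS · elementary certificate; cite: BoubakriGreuelMarkwig2010, §3 (p. 10)] -/
theorem weaklyNondegenerate_bed52 (k : Type) [Field k] [CharP k 2] (a b c d e : ℕ) (hb : Odd b) (hc : Odd c) (hd : Odd d) (he : Odd e) (f : MvPolynomial (Fin 6) k)
    (hf : f = X 5 ^ 2 + X 0 ^ a * X 5 + X 1 ^ b + X 2 ^ c + X 3 ^ d + X 4 ^ e) :
    ∀ w : Fin 6 → ℝ, (∀ i, 0 < w i) → IsWeaklyNondegenerateAlong w (f : MvPowerSeries (Fin 6) k) := by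
  classical
  have hf' : f = monomial (Finsupp.single 5 2) 1 + monomial (Finsupp.single 0 a + Finsupp.single 5 1) 1 + monomial (Finsupp.single 1 b) 1 +
      monomial (Finsupp.single 2 c) 1 + monomial (Finsupp.single 3 d) 1 + monomial (Finsupp.single 4 e) 1 := by
    rw [hf]; simp only [X_pow_eq_monomial]; rw [X, monomial_mul, mul_one]
  have hsupp : ∀ α ∈ f.support, α = Finsupp.single 5 2 ∨ α = Finsupp.single 0 a + Finsupp.single 5 1 ∨ α = Finsupp.single 1 b ∨
      α = Finsupp.single 2 c ∨ α = Finsupp.single 3 d ∨ α = Finsupp.single 4 e := by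
    intro α hα
    rw [hf'] at hα
    rcases mem_support_add6 hα with h | h | h | h | h | h
    · exact Or.inl (eq_of_mem_support_monomial h)
    · exact Or.inr (Or.inl (eq_of_mem_support_monomial h))
    · exact Or.inr (Or.inr (Or.inl (eq_of_mem_support_monomial h)))
    · exact Or.inr (Or.inr (Or.inr (Or.inl (eq_of_mem_support_monomial h))))
    · exact Or.inr (Or.inr (Or.inr (Or.inr (Or.inl (eq_of_mem_support_monomial h)))))
    · exact Or.inr (Or.inr (Or.inr (Or.inr (Or.inr (eq_of_mem_support_monomial h)))))
  have hf0 : f ≠ 0 := by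
    intro h0
    have := congrArg (MvPolynomial.eval (Pi.single 1 1 : Fin 6 → k)) h0
    rw [hf] at this
    simp [zero_pow hc.pos.ne', zero_pow hd.pos.ne', zero_pow he.pos.ne'] at this
  have h2 : (2 : k) = 0 := by simpa using natCast_eq_zero_of_dvd (k := k) 2 2 dvd_rfl
  have hodd : ∀ n : ℕ, Odd n → ((n : ℕ) : k) ≠ 0 := fun n hn =>
    natCast_ne_zero_of_not_dvd 2 n (Nat.two_dvd_ne_zero.mpr (Nat.odd_iff.mp hn))
  refine weaklyNondegenerate_of_good_support f hf0 (Finsupp.single 5 2) (fun α hα hne => ?_)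
  rcases hsupp α hα with rfl | rfl | rfl | rfl | rfl | rfl
  · exact (hne rfl).elim
  · refine ⟨5, by simp, fun β hβ hβne => ?_⟩
    rcases hsupp β hβ with rfl | rfl | rfl | rfl | rfl | rfl
    · simp [h2]
    · exact (hβne rfl).elim
    · simp
    · simp
    · simp
    · simp
  · refine ⟨1, by simpa using hodd b hb, fun β hβ hβne => ?_⟩
    rcases hsupp β hβ with rfl | rfl | rfl | rfl | rfl | rfl
    · simp
    · simp
    · exact (hβne rfl).elim
    · simp
    · simp
    · simp
  · refine ⟨2, by simpa using hodd c hc, fun β hβ hβne => ?_⟩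
    rcases hsupp β hβ with rfl | rfl | rfl | rfl | rfl | rfl
    · simp
    · simp
    · simp
    · exact (hβne rfl).elim
    · simp
    · simp
  · refine ⟨3, by simpa using hodd d hd, fun β hβ hβne => ?_⟩
    rcases hsupp β hβ with rfl | rfl | rfl | rfl | rfl | rfl
    · simp
    · simp
    · simp
    · simp
    · exact (hβne rfl).elim
    · simp
  · refine ⟨4, by simpa using hodd e he, fun β hβ hβne => ?_⟩
    rcases hsupp β hβ with rfl | rfl | rfl | rfl | rfl | rfl
    · simp
    · simp
    · simp
    · simp
    · simp
    · exact (hβne rfl).elim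

end Summit.ResolutionOfSingularities.ResolutionOfSingularities.Theorems.FInjectiveMacaulayfication.CensusBedsWeaklyNondegenerate

end
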